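import Literature.AlgebraicGeometry.HodgeTheory.CyclicCoverPencilMonodromyMap
import Literature.Geometry.Manifold.ShellInterpolatedIsotopyInverse
import HarnessLib

/-!
# The geometric monodromy map of the nodal pencil — bijectivity of the fibre maps

Family `hodge`, layer `Literature/AlgebraicGeometry/HodgeTheory`; step A3c′ of the programme discharging
`carlsonToledo1999_nodalMeridianLocalMonodromyBound` (crux K1 of
`Summits/HodgeConjecture/HodgeConjecture/Theses/CyclicUnitaryPowers.lean`). The theorem `exists_pencil_monodromyMap` of
`CyclicCoverPencilMonodromyMap` is re-run with one more recorded output of the shell interpolation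
(`ShellInterpolatedIsotopyInverse.apply_shellInverse'`): the explicit inverse `k(u, ·)` of `h(u, ·)` covers the rotation
`c ↦ e^{−2πiu} c` and preserves the saturated Morse radius `F` below `T`. Consequently `h(u, ·)` maps the member `X_c` of the
pencil ONTO `X_{e^{2πiu}c}` (not merely into), i.e. the fibre maps of the geometric monodromy are bijections — the form in which
they are fed to `DirectImageIsotopy` (a continuous bijection of compact Hausdorff fibres is a homeomorphism, hence injective on
cohomology). Arnold–Gusein-Zade–Varchenko II §1.1, Milnor §9 Lemma 9.4.

Everything is proved; no definitions, no named facts.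

## References

* [ArnoldGuseinzadeVarchenko2012] V. I. Arnold, S. M. Gusein-Zade, A. N. Varchenko, Singularities of Differentiable Maps II (2012),
  Part I §1.1 (held text p0013, p0025), §2.1.
* [Milnor1968] J. Milnor, Singular Points of Complex Hypersurfaces, §9 Lemma 9.4.
* [CarlsonToledo1999] J. A. Carlson, D. Toledo, Duke Math. J. 97 (1999), §6 (kdoublept).
-/

noncomputable section

open CategoryTheory AlgebraicGeometry MvPolynomial TopologicalSpace Set Topology Filter Complex
open scoped Manifold ContDiff Real
open Literature.AlgebraicGeometry.Motives Literature.AlgebraicGeometry.Motives.UniversalHypersurface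
open Literature.AlgebraicGeometry.HodgeTheory.UniversalHypersurface Literature.Geometry.ComplexAnalytic Literature.Geometry.Manifold

namespace Literature.AlgebraicGeometry.HodgeTheory

section MonodromyMapInverse

variable {p : ℕ} (hp : 3 ≤ p)
  (Φ : OpenPartialHomeomorph (ComplexPoints (regularTotal ℂ 2 p)) (({m : DegIndex 2 p // m ≠ regPowIndex 2 p 2} ⊕ Fin (2 + 1)) → ℂ))
  (hΦ : ⇑Φ = regChartFun 2 p 2) (hΦs : Φ.source = regChartDom 2 p 2) (hΦt : Φ.target = regChartFun 2 p 2 '' regChartDom 2 p 2)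
  (Θ : OpenPartialHomeomorph (Fin (1 + 2) → ℂ) (Fin (1 + 2) → ℂ)) {r R''' R'' : ℝ}
  (hr : {z : Fin (1 + 2) → ℂ | ∑ i, ‖z i‖ ^ 2 ≤ r ^ 2} ⊆ Θ.target)
  (hΘφ : ∀ x ∈ Θ.source, ∑ i, (Θ x) i ^ PhamBrieskorn.cyclicNodeExponents p i = x 2 ^ p - (x 0 * x 1 + x 0 ^ p + x 1 ^ p))
  {ρW : ℝ} (hρW : 0 < ρW)
  (hns : ∀ c : ℂ, c ≠ 0 → ‖c‖ < ρW → SmoothHypersurface.IsNonsingularForm ℂ (formOfCoeffs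
    (coeffsOf 2 p (cyclicCoverForm p (X 2 ^ (p - 2) * (X 0 * X 1) + X 0 ^ p + X 1 ^ p)) - Pi.single (regPowIndex 2 p 2) c)))
  (hR : R''' < R'') {T : ℝ} (hTR : T ≤ R''') (hTr : T ≤ r ^ 2)
include hp hΦ hΦs hΦt hr hΘφ hρW hns hR hTR hTr

variable (hT0 : 0 < T) (g : ℝ × ComplexPoints (regularTotal ℂ 2 p) → ComplexPoints (regularTotal ℂ 2 p)) (hgc : Continuous g)
  (hg0 : ∀ q, g (0, q) = q) (hg2π : ∀ q, g (2 * π, q) = q) {s₀ s₁ r₂ : ℝ}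
  (hgO : ∀ θ, ∀ q ∈ invariantSet p Θ R''' R'' s₁, ‖pencilCoord p q‖ < ρW →
    g (θ, q) ∈ invariantSet p Θ R''' R'' s₁ ∧ pencilCoord p (g (θ, q)) = Complex.exp (θ * I) * pencilCoord p q)
  (hgadd : ∀ θ θ', ∀ q ∈ invariantSet p Θ R''' R'' s₁, ‖pencilCoord p q‖ < ρW → g (θ + θ', q) = g (θ, g (θ', q)))
  (hgS : ∀ θ q, q ∈ pencilSlice p → g (θ, q) ∈ pencilSlice p)
  (hgF : ∀ θ q, q ∈ pencilSlice p → s₀ ^ 2 < satRadius p Θ R''' R'' q → satRadius p Θ R''' R'' q < r₂ ^ 2 →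
    satRadius p Θ R''' R'' (g (θ, q)) = satRadius p Θ R''' R'' q)
  (hs₀₁ : s₀ ^ 2 < s₁ ^ 2) (hTr₂ : T ≤ r₂ ^ 2) {δ₀ : ℝ} (hδ₀ : δ₀ ≤ ρW / 4)
include hT0 hgc hg0 hg2π hgO hgadd hgS hgF hs₀₁ hTr₂ hδ₀

/-- **The geometric monodromy map of the nodal pencil on the slice, with the rotation covered by the inverse.** Same as
`exists_pencil_monodromyMap`, recording in addition that the inverse `k(u, ·)` covers the rotation by `−2πu` and preserves `F` below `T`
(so `h(u, ·) : X_c → X_{e^{2πiu}c}` is a bijection with inverse `k(u, ·)`). Radii `s₁² ≤ t₁ < t₂ ≤ T' < T` (`T ≤ min(R''', r², r₂²)`),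
disc `|c| < δ₀ ≤ ρW/4`. There are self-maps `h, k, H` of `ℝ × S` such that, at the points `x ∈ S` with `c(x) ≠ 0` (and
`|c(x)| < δ₀` where indicated): `h` is continuous on `ℝ × {c ≠ 0}`; `h(0, x) = x`; `c(h(u, x)) = e^{2πiu} c(x)`, `F(h(u, x)) = F(x)` if
`F(x) < T`, `F(h(u, x)) > T'` if `F(x) > T'`; `k(u, ·)` is a two-sided inverse of `h(u, ·)`; **`h(1, x) = x` if `F(x) ≥ t₂`**; and `H` is
continuous on `ℝ × {F < T, 0 < |c| < δ₀}` with `c(H(s, x)) = c(x)`, `F(H(s, x)) = F(x)`, **`H(0, x) = J(2π, x)`** (the model monodromy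
`Φ⁻¹(b'₀, Θ⁻¹R_{2π}Θ y(x))`) and `H(1, x) = h(1, x)` if `F(x) ≤ T'`. [cite: ArnoldGuseinzadeVarchenko2012, Part I §1.1 (held text p0013, p0025)]
[cite: Milnor1968, §9 Lemma 9.4] -/
theorem exists_pencil_monodromyMap' (hΘ : ContDiffOn ℝ ∞ Θ Θ.source)
    (hR'' : {z : Fin (1 + 2) → ℂ | ∑ i, ‖z i‖ ^ 2 ≤ R''} ⊆ Θ.target)
    {t₁ t₂ T' : ℝ} (ht₁ : s₁ ^ 2 ≤ t₁) (ht₁₂ : t₁ < t₂) (ht₂ : t₂ ≤ T') (hT' : T' < T) :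
    ∃ h k H : ℝ × pencilSlice p → pencilSlice p,
      (Continuous fun ux : ℝ × {x : pencilSlice p // pencilCoord p x.1 ≠ 0} => h (ux.1, ux.2.1)) ∧
      (∀ x, pencilCoord p x.1 ≠ 0 → h (0, x) = x) ∧
      (∀ u x, pencilCoord p x.1 ≠ 0 → ‖pencilCoord p x.1‖ < δ₀ →
        pencilCoord p (h (u, x)).1 = Complex.exp (((2 * π * u : ℝ) : ℂ) * I) * pencilCoord p x.1 ∧
        (satRadius p Θ R''' R'' x.1 < T → satRadius p Θ R''' R'' (h (u, x)).1 = satRadius p Θ R''' R'' x.1) ∧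
        (T' < satRadius p Θ R''' R'' x.1 → T' < satRadius p Θ R''' R'' (h (u, x)).1) ∧
        k (u, h (u, x)) = x ∧ h (u, k (u, x)) = x ∧
        pencilCoord p (k (u, x)).1 = Complex.exp (((-(2 * π * u) : ℝ) : ℂ) * I) * pencilCoord p x.1 ∧
        (satRadius p Θ R''' R'' x.1 < T → satRadius p Θ R''' R'' (k (u, x)).1 = satRadius p Θ R''' R'' x.1)) ∧
      (∀ x, pencilCoord p x.1 ≠ 0 → ‖pencilCoord p x.1‖ < δ₀ → t₂ ≤ satRadius p Θ R''' R'' x.1 → h (1, x) = x) ∧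
      ContinuousOn H (univ ×ˢ {x : pencilSlice p |
        satRadius p Θ R''' R'' x.1 < T ∧ pencilCoord p x.1 ≠ 0 ∧ ‖pencilCoord p x.1‖ < δ₀}) ∧
      (∀ s x, pencilCoord p x.1 ≠ 0 → ‖pencilCoord p x.1‖ < δ₀ → satRadius p Θ R''' R'' x.1 < T →
        pencilCoord p (H (s, x)).1 = pencilCoord p x.1 ∧
        satRadius p Θ R''' R'' (H (s, x)).1 = satRadius p Θ R''' R'' x.1 ∧
        (H (0, x)).1 = chartModelIsotopy (PhamBrieskorn.cyclicNodeExponents p) Φ Θ (2 * π) x.1 ∧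
        (satRadius p Θ R''' R'' x.1 ≤ T' → H (1, x) = h (1, x))) := by
  -- the data of `ShellInterpolatedIsotopyPunctured` on `M = S`
  let ρ : pencilSlice p → ℝ := fun x => cutRadius p Θ R''' R'' T ρW x.1
  let pc : pencilSlice p → ℂ := fun x => pencilCoord p x.1
  let J : ℝ × pencilSlice p → pencilSlice p := fun q =>
    restrictIf (pencilSlice p) (chartModelIsotopy (PhamBrieskorn.cyclicNodeExponents p) Φ Θ q.1) q.2
  let G : ℝ × pencilSlice p → pencilSlice p := fun q => restrictIf (pencilSlice p) (fun x => g (q.1, x)) q.2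
  let lam : ℝ → ℝ := fun t => Real.smoothTransition ((t - t₁) / (t₂ - t₁))
  have hρc : Continuous ρ := (continuous_cutRadius p Θ R''' R'' T ρW (by omega) hΘ hR hR'').comp continuous_subtype_val
  have hlam : Continuous lam :=
    Real.smoothTransition.continuous.comp ((continuous_id.sub continuous_const).div_const _)
  have hlam₀ : ∀ t, t ≤ t₁ → lam t = 0 := fun t ht =>
    Real.smoothTransition.zero_of_nonpos (div_nonpos_of_nonpos_of_nonneg (by linarith) (by linarith))
  have hlam₁ : ∀ t, t₂ ≤ t → lam t = 1 := fun t ht =>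
    Real.smoothTransition.one_of_one_le (by rw [le_div_iff₀ (by linarith)]; linarith)
  have hI : ∀ θ x, ρ x < T → pc x ≠ 0 → ρ (J (θ, x)) = ρ x ∧ pc (J (θ, x)) = Complex.exp ((θ : ℂ) * I) * pc x :=
    fun θ x hρ hc0 => monodromyMap_hI hp Φ hΦ hΦs hΦt Θ hr hΘφ hρW hns hR hTR hTr θ x hρ hc0
  have hI0 : ∀ x, ρ x < T → pc x ≠ 0 → J (0, x) = x :=
    fun x hρ hc0 => monodromyMap_hI0 hp Φ hΦ hΦs hΦt Θ hr hΘφ hρW hns hR hTR hTr x hρ hc0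
  have hIadd : ∀ θ θ' x, ρ x < T → pc x ≠ 0 → J (θ + θ', x) = J (θ, J (θ', x)) :=
    fun θ θ' x hρ hc0 => monodromyMap_hIadd hp Φ hΦ hΦs hΦt Θ hr hΘφ hρW hns hR hTR hTr θ θ' x hρ hc0
  have hIcont : ContinuousOn J (univ ×ˢ {x | ρ x < T ∧ pc x ≠ 0}) :=
    monodromyMap_hIcont hp Φ hΦ hΦs hΦt Θ hr hΘφ hρW hns hR hTR hTr
  have hG0 : ∀ q, G (0, q) = q := fun q => restrictIf_of_apply_eq _ _ (hg0 q.1)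
  have hG2π : ∀ q, G (2 * π, q) = q := fun q => restrictIf_of_apply_eq _ _ (hg2π q.1)
  have hGO : ∀ θ q, s₁ ^ 2 < ρ q → ‖pc q‖ < δ₀ → s₁ ^ 2 < ρ (G (θ, q)) ∧ pc (G (θ, q)) = Complex.exp ((θ : ℂ) * I) * pc q :=
    fun θ q hρ hq => monodromyMap_hgO Θ hρW hR hTR hT0 g hgO hgS hδ₀ θ q hρ hq
  have hGadd : ∀ θ θ' q, s₁ ^ 2 < ρ q → ‖pc q‖ < δ₀ → G (θ + θ', q) = G (θ, G (θ', q)) :=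
    fun θ θ' q hρ hq => monodromyMap_hgadd Θ hρW hR hTR hT0 g hgadd hgS hδ₀ θ θ' q hρ hq
  have hGρ : ∀ θ q, s₁ ^ 2 < ρ q → ‖pc q‖ < δ₀ → ρ q < T → ρ (G (θ, q)) = ρ q :=
    fun θ q hρ hq hρT => monodromyMap_hgρ Θ hρW hR hTR hT0 g hgO hgS hgF hs₀₁ hTr₂ hδ₀ θ q hρ hq hρT
  have hGcont : Continuous G := monodromyMap_hgcont g hgc hgS
  have hs₀₁' : s₁ ^ 2 ≤ t₁ := ht₁
  -- the three maps
  refine ⟨fun ux => if ρ ux.2 ≤ T' then G (2 * π * ux.1 * lam (ρ ux.2), J (2 * π * ux.1 * (1 - lam (ρ ux.2)), ux.2))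
      else G (2 * π * ux.1, ux.2),
    fun ux => if ρ ux.2 ≤ T' then J (-(2 * π * ux.1 * (1 - lam (ρ ux.2))), G (-(2 * π * ux.1 * lam (ρ ux.2)), ux.2))
      else G (-(2 * π * ux.1), ux.2),
    fun sx => G (2 * π * sx.1 * lam (ρ sx.2), J (2 * π * (1 - sx.1 * lam (ρ sx.2)), sx.2)),
    ?_, ?_, ?_, ?_, ?_, ?_⟩
  · exact continuous_shellIsotopy' hρc ht₂ hT' hlam hlam₁ hIcont hI0 hGcont
  · intro x hx0
    exact shellIsotopy_zero' (lam := lam) hT' hI0 hG0 hx0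
  · intro u x hx0 hxδ
    have hρx : ρ x = satRadius p Θ R''' R'' x.1 := monodromyMap_cutRadius_eq Θ hρW hR hTR hT0 hδ₀ hxδ
    obtain ⟨hpc, hρ₁, hρ₂⟩ := apply_shellIsotopy' hs₀₁' ht₁₂ ht₂ hT' hlam₀ hI hG0 hGO hGadd hGρ u hxδ hx0
    have hnorm : ‖pc (if ρ x ≤ T' then G (2 * π * u * lam (ρ x), J (2 * π * u * (1 - lam (ρ x)), x))
        else G (2 * π * u, x))‖ < δ₀ := by
      rw [hpc, norm_mul, Complex.norm_exp_ofReal_mul_I, one_mul]; exact hxδ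
    have hρh := monodromyMap_cutRadius_eq Θ hρW hR hTR hT0 hδ₀ hnorm
    obtain ⟨hpk, hρk⟩ := apply_shellInverse' hs₀₁' ht₁₂ ht₂ hT' hlam₀ hI hG0 hGO hGρ u hxδ hx0
    have hnormk : ‖pc (if ρ x ≤ T' then J (-(2 * π * u * (1 - lam (ρ x))), G (-(2 * π * u * lam (ρ x)), x))
        else G (-(2 * π * u), x))‖ < δ₀ := by
      rw [hpk, norm_mul, Complex.norm_exp_ofReal_mul_I, one_mul]; exact hxδ
    have hρhk := monodromyMap_cutRadius_eq Θ hρW hR hTR hT0 hδ₀ hnormk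
    refine ⟨hpc, fun hF => ?_, fun hF => ?_, ?_, ?_, hpk, fun hF => ?_⟩
    · have h := hρ₁ (by rw [hρx]; exact hF)
      exact hρh.symm.trans (h.trans hρx)
    · have h := hρ₂ (by rw [hρx]; exact hF)
      exact lt_of_lt_of_eq h hρh
    · exact shellIsotopy_leftInverse' hs₀₁' ht₁₂ ht₂ hT' hlam₀ hI hI0 hIadd hG0 hGO hGadd hGρ u hxδ hx0
    · exact shellIsotopy_rightInverse' hs₀₁' ht₁₂ ht₂ hT' hlam₀ hI hI0 hIadd hG0 hGO hGadd hGρ u hxδ hx0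
    · have h := hρk (by rw [hρx]; exact hF)
      exact hρhk.symm.trans (h.trans hρx)
  · intro x hx0 hxδ hF
    have hρx : ρ x = satRadius p Θ R''' R'' x.1 := monodromyMap_cutRadius_eq Θ hρW hR hTR hT0 hδ₀ hxδ
    exact shellIsotopy_one_of_ge' hT' hlam₁ hI0 hG2π (by rw [hρx]; exact hF) hx0
  · refine (continuousOn_shellHomotopy' hρc hlam hIcont hGcont).mono (prod_mono le_rfl ?_)
    rintro x ⟨hF, hx0, hxδ⟩
    have hρx : ρ x = satRadius p Θ R''' R'' x.1 := monodromyMap_cutRadius_eq Θ hρW hR hTR hT0 hδ₀ hxδ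
    exact ⟨by rw [hρx]; exact hF, hx0⟩
  · intro s x hx0 hxδ hF
    have hρx : ρ x = satRadius p Θ R''' R'' x.1 := monodromyMap_cutRadius_eq Θ hρW hR hTR hT0 hδ₀ hxδ
    have hρT : ρ x < T := by rw [hρx]; exact hF
    obtain ⟨hpc, hρH, hH0, hH1⟩ := apply_shellHomotopy' hs₀₁' hlam₀ hI hG0 hGO hGρ s hxδ hx0 hρT
    have hnorm : ‖pc (G (2 * π * s * lam (ρ x), J (2 * π * (1 - s * lam (ρ x)), x)))‖ < δ₀ := by rw [hpc]; exact hxδ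
    have hρh := monodromyMap_cutRadius_eq Θ hρW hR hTR hT0 hδ₀ hnorm
    refine ⟨hpc, hρh.symm.trans (hρH.trans hρx), ?_, fun hF' => hH1 (by rw [hρx]; exact hF')⟩
    change (G (2 * π * (0 : ℝ) * lam (ρ x), J (2 * π * (1 - (0 : ℝ) * lam (ρ x)), x))).1 = _
    rw [hH0]
    obtain ⟨hF', hcρ⟩ := monodromyMap_good_of_cutRadius_lt Θ hρW hρT
    exact monodromyMap_model_coe hp Φ hΦ hΦs hΦt Θ hr hΘφ hns hR hTR hTr hF' hx0 hcρ (2 * π)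

end MonodromyMapInverse

end Literature.AlgebraicGeometry.HodgeTheory

end
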